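import Summits.AtomisticToContinuum.Crystallization.Theorems.ExcessDecayLiouvilleGlobalGradient

/-!
# Route `ExcessDecayLiouville`: the global gradient bound, assembled (nonlinear half, XXX)

Harmonic-replacement architecture for item `ExcessDecay` (stmt-AtomisticToContinuum-9334), nonlinear half.
`global_gradient`: for the main cut-off `χ` (`|χ| ≤ 1`, Lipschitz `1/w` on the sites, vanishing beyond
`3r/4` from `c`) and a relaxed small approximant, the nearest-neighbour form of `v = χ·ũ` on ANY ball is at
most `NN_tot = 2·40·(1.1/w)²·32(3r/4+2)³ D_u² + 2·G` for any bound `G` of `NN[ũ, c, 13r/16]` (to be supplied by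
`step_gradient` at the auxiliary cut-off `χ′ = 1` on `B_{7r/8}(c)`, radii `(13r/16, 27r/32)`, crude currencies;
see `step_forcing_gen`).  Also `farMass_le_inv_mul_mass` (a weighted far mass below the total mass).
All `[folklore]`; helper lemmas, nothing here closes an item.
-/

noncomputable section

namespace Summit.AtomisticToContinuum.Crystallization.Theorems.ExcessDecayLiouville

open scoped BigOperators Topology Classical
open Literature.MathematicalPhysics.StatisticalMechanics
open Summit.AtomisticToContinuum.Crystallization.Theorems.PhononStabilityNegative

set_option quotPrecheck false in
-- Local notation: ball indicator.
local notation "𝟙ᵇ[" x ", " c ", " R "]" => (if dist (x : EuclideanSpace ℝ (Fin 3)) c ≤ R then (1 : ℝ) else 0)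

section

variable {c : EuclideanSpace ℝ (Fin 3)}
  {t : Fin 2 → EuclideanSpace ℝ (Fin 3)} {A : EuclideanSpace ℝ (Fin 3) →L[ℝ] EuclideanSpace ℝ (Fin 3)}

variable (hA : Adm₀ A) (hI : Inner₀ t A)

set_option quotPrecheck false in
-- Local notation: the finite near-neighbour form on the ball of radius `X` about the centre `cc`.
local notation "NN[" v ", " cc ", " X "]" =>
  (∑ p ∈ (finite_sites_dist_le (t := t) (A := A) hA hI cc X).toFinset,
    ∑ q ∈ (finite_sites_dist_le (t := t) (A := A) hA hI cc X).toFinset,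
      (if p ≠ q ∧ dist p q ≤ 11 / 10 then ‖v p - v q‖ ^ 2 else (0 : ℝ)))

/-- **A weighted far mass below the total mass**: `Σ' ‖f q‖² max(d, Y)⁻⁸ ≤ Y⁻⁸ Σ' ‖f q‖² 𝟙[dist q c ≤ r]` if `f`
vanishes at the sites beyond `r` from `c` (`Y > 0`). [folklore] -/
theorem farMass_le_inv_mul_mass (f : (EuclideanSpace ℝ (Fin 3)) → (EuclideanSpace ℝ (Fin 3))) (hf : (Function.support f).Finite)
    (c cc : EuclideanSpace ℝ (Fin 3)) {r Y : ℝ} (hY : 0 < Y) (hsupp : ∀ x ∈ Sites₀ t A, r < dist x c → f x = 0) :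
    ∑' q : Sites₀ t A, ‖f q‖ ^ 2 * (max (dist (q : EuclideanSpace ℝ (Fin 3)) cc) Y)⁻¹ ^ 8 ≤
      Y⁻¹ ^ 8 * ∑' q : Sites₀ t A, ‖f q‖ ^ 2 * 𝟙ᵇ[q, c, r] := by
  have hs1 := summable_normSq_mul_of_finite (t := t) (A := A) hf (fun q => (max (dist q cc) Y)⁻¹ ^ 8)
  have hs2 := summable_normSq_mul_of_finite (t := t) (A := A) hf (fun q => 𝟙ᵇ[q, c, r])
  have hpt : ∀ q : Sites₀ t A, ‖f q‖ ^ 2 * (max (dist (q : EuclideanSpace ℝ (Fin 3)) cc) Y)⁻¹ ^ 8 ≤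
      (‖f q‖ ^ 2 * 𝟙ᵇ[q, c, r]) * Y⁻¹ ^ 8 := by
    intro q
    by_cases hq : dist (q : EuclideanSpace ℝ (Fin 3)) c ≤ r
    · rw [if_pos hq, mul_one]
      have hw : (max (dist (q : EuclideanSpace ℝ (Fin 3)) cc) Y)⁻¹ ^ 8 ≤ Y⁻¹ ^ 8 :=
        pow_le_pow_left₀ (by positivity) ((inv_le_inv₀ (lt_max_of_lt_right hY) hY).2 (le_max_right _ _)) 8
      exact mul_le_mul_of_nonneg_left hw (sq_nonneg _)
    · rw [hsupp q q.2 (lt_of_not_ge hq), norm_zero]; simp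
  calc _ ≤ ∑' q : Sites₀ t A, (‖f q‖ ^ 2 * 𝟙ᵇ[q, c, r]) * Y⁻¹ ^ 8 := hs1.tsum_le_tsum hpt (hs2.mul_right _)
    _ = _ := by rw [tsum_mul_right, mul_comm]

include hA hI in
/-- **The global gradient bound** (see the module docstring): `NN[χ·ũ, c₀, X] ≤ 2·40·(1.1/w)²·32(3r/4+2)³D_u² + 2·G`
for any bound `G` of `NN[ũ, c, 13r/16]` (e.g. `aux_gradient`). [folklore] -/
theorem global_gradient {r : ℝ} (hr : 64 ≤ r)
    (SR : Finset (EuclideanSpace ℝ (Fin 3))) (hSR : ∀ x, x ∈ SR ↔ x ∈ Sites₀ t A ∧ dist x c ≤ r)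
    (χ : EuclideanSpace ℝ (Fin 3) → ℝ) (hχabs : ∀ x, |χ x| ≤ 1) {wχ : ℝ} (hw : 0 < wχ)
    (hlip : ∀ p q : Sites₀ t A, |χ p - χ q| ≤ ‖(p : EuclideanSpace ℝ (Fin 3)) - q‖ / wχ)
    (hχfar : ∀ x ∈ Sites₀ t A, 3 * r / 4 < dist x c → χ x = 0)
    (ut : (EuclideanSpace ℝ (Fin 3)) → (EuclideanSpace ℝ (Fin 3))) {Du G : ℝ} (hDu : ∀ x ∈ SR, ‖ut x‖ ≤ Du)
    (hG : NN[ut, c, 13 * r / 16] ≤ G) (c₀ : EuclideanSpace ℝ (Fin 3)) (Xr : ℝ) :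
    NN[(fun x => χ x • ut x), c₀, Xr] ≤ 2 * (40 * ((11 / 10) / wχ) ^ 2) * (32 * (3 * r / 4 + 2) ^ 3 * Du ^ 2) + 2 * G := by
  -- (1) change of centre: v vanishes beyond 3r/4 from c
  have hv0 : ∀ x ∈ Sites₀ t A, (3 * r / 4 + 2) - 11 / 10 < dist x c → (fun x => χ x • ut x) x = 0 := by
    intro x hx hxd
    simp only []
    rw [hχfar x hx (by linarith), zero_smul]
  have h1 := NN_le_NN_of_support hA hI (fun x => χ x • ut x) c₀ c (X := Xr) hv0
  refine h1.trans ((NN_smul_split hA hI ut χ hχabs hw hlip c (3 * r / 4 + 2)).trans ?_)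
  have hmemF : ∀ x ∈ (finite_sites_dist_le (t := t) (A := A) hA hI c (3 * r / 4 + 2)).toFinset, x ∈ Sites₀ t A ∧ dist x c ≤ 3 * r / 4 + 2 :=
    fun x hx => by
      have h := (Set.Finite.mem_toFinset (finite_sites_dist_le (t := t) (A := A) hA hI c (3 * r / 4 + 2))).1 hx
      exact h
  have hsumu : ∑ p ∈ (finite_sites_dist_le (t := t) (A := A) hA hI c (3 * r / 4 + 2)).toFinset, ‖ut p‖ ^ 2 ≤
      32 * (3 * r / 4 + 2) ^ 3 * Du ^ 2 := by
    calc _ ≤ ∑ p ∈ (finite_sites_dist_le (t := t) (A := A) hA hI c (3 * r / 4 + 2)).toFinset, Du ^ 2 := by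
          refine Finset.sum_le_sum fun p hp => ?_
          obtain ⟨hpS, hpd⟩ := hmemF p hp
          exact pow_le_pow_left₀ (norm_nonneg _) (hDu p ((hSR p).2 ⟨hpS, by linarith⟩)) 2
      _ = (finite_sites_dist_le (t := t) (A := A) hA hI c (3 * r / 4 + 2)).toFinset.card * Du ^ 2 := by
          rw [Finset.sum_const, nsmul_eq_mul]
      _ ≤ 32 * (3 * r / 4 + 2) ^ 3 * Du ^ 2 :=
          mul_le_mul_of_nonneg_right (card_ball_sites_le hA hI c (by linarith) _ hmemF) (sq_nonneg _)
  have h3 : NN[ut, c, 3 * r / 4 + 2] ≤ G := (NN_mono hA hI ut (by linarith : 3 * r / 4 + 2 ≤ 13 * r / 16)).trans hG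
  have h0 : 0 ≤ 2 * (40 * ((11 / 10) / wχ) ^ 2) := by positivity
  nlinarith [mul_le_mul_of_nonneg_left hsumu h0, h3]

end

end Summit.AtomisticToContinuum.Crystallization.Theorems.ExcessDecayLiouville

end
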